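import Literature.NumberTheory.LFunctions.Polymath15RtnEstimate
import HarnessLib

/-!
# Polymath 15, Proposition 6.6 (iv)–(vi): the error majorants `e_A + e_B ≤ errAB`, `e_{C,0} ≤ errC0`

Topic `Literature/NumberTheory/LFunctions` (companion of `Polymath15EffectiveApproximation.lean` —
the objects of Polymath 15, §1 and Thm. 1.3 with the printed majorants `errAB`, `errC0` and the
named fact `Polymath15.effective_approximation` —, of `Polymath15EffectiveApproximationProofs.lean`
— Prop. 6.6 (i)–(iii) proved — and of `Polymath15RtnEstimate.lean` — Prop. 6.1 and `ε_{t,n}`).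
Everything here is PROVED; there are no named facts. This is item **E4a** (`error_majorants`) of
the typed decomposition of the printed proof of Thm. 1.3 (§4 + §6 of the source).

## Contents

* the objects of Prop. 6.3 and §6.3: `epsTilde` (eq. (epsp-def)), `rsA` (`a = √(T'/2π)`,
  `T' = T + πt/8`), and the error terms `eA`, `eB`, `eC0` of eqs. (ea-def), (eb-def), (ec0-def)
  (token-identical to the planner's sketch of the decomposition);
* the real and imaginary parts of `α(s) = 1/(2s) + 1/(s−1) + (1/2)Log(s/2π)` (`re_alpha_eq`,
  `im_alpha_eq`) and the bounds on the line `Im s = b`, `0 ≤ Re s ≤ 1`: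
  `−1/b² ≤ Re α(s) − (1/2)log(b/2π) ≤ 3/(4b²)` (`re_alpha_sub_log_bounds`), `|Im α(s)| ≤ π/4`
  (`abs_im_alpha_le`);
* (iv)–(v): `norm_alpha_sub_log_sq_le` (`|α(s) − log n|² ≤ (1/4)log²(x/4πn²) + 0.667`),
  `epsTN_le` (`ε_{t,n}(s_±) ≤ exp(((t²/16)log²(x/4πn²) + 0.626)/(x − 6.66)) − 1`),
  `le_of_mem_Icc_rsN` (`1 ≤ n ≤ N ⇒ n ≤ x/4π`) and `eA_add_eB_le_errAB`;
* (vi): `alpha_I_mul_re_im` (`α(iT')` exactly), `neg_re_alpha_mul_le`, `re_alpha_sq_ge`,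
  `Q_le` (`e^{tπ²/64}|M₀(iT')|/|M_t(s₊)| ≤ (x/4π)^{−(1+y)/4} e^{−(t/16)log²(x/4π) + log(x/4π)/(2x²) + 3.58/(x−6)}`),
  `exp_mul_one_add_epsTilde_le`, `eC0_le_errC0`;
* `error_majorants : ∀ t x y, EffRegion t x y → eA + eB ≤ errAB ∧ eC0 ≤ errC0`.

## Deviations from the printed proof (the STATEMENTS proved are the printed ones)

1. Eq. (asig), `α(σ + ix/2) = (1/2)log(x/4π) + iπ/4 + O_≤((2+σ)/(x−6))`, undercounts the term
   `1/(s−1)` (of size `2/x`; cf. the remark in `Polymath15EffectiveApproximationProofs.lean` for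
   (i)). We do not use (asig): the real part of `α(s) − (1/2)log(x/4π)` is `O_≤(4/x²)` exactly and
   `|Im α(s)| ≤ π/4`, which gives (alphn) with constant `π²/16 + 0.002 ≤ 0.667` and the lower
   bound for `Re α(s̄₊)²` in (vi) with room.
2. In (vi) the printed step `ε̃((1±y+ix)/2) ≤ 1.24×3^{±y}/(a − 0.125) + 1.73/(T−6)` does not follow
   from (epsp-def), whose denominator is `a − 0.865` (and `1/(a − 0.865) > 1/(a − 0.125)`); likewise
   the constants `3.58/(x−8.52) + 6.92/(x−12)` of Prop. 6.6 (vi) sum to `10.50`, not the `10.44` of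
   Thm. 1.3. The bound of Thm. 1.3 (as vendored in `errC0`) nevertheless holds: Thm. 1.3 passes
   from Prop. 6.6 (vi) to (1.9) by `1 + u ≤ e^u` with `u ≥ 2.48/(N − 0.125)`, and the slack
   `e^u − 1 − u ≥ u²/2` absorbs the discrepancy for every `a ≥ 3.98` (`main_term_le`:
   `1.2386/(a−0.865) ≤ 1.24/(a−0.125) + 1.5376/(a−0.125)²`), while the additive constants have room
   `6.94 + 3.58 + 0.05 ≤ 15.15 ≤ 3·(π/2) + 10.44` (`additive_term_le`). So `eC0 ≤ errC0` is proved
   with the printed right-hand side, by a slightly different bookkeeping than printed.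
3. `exp(3.49/(T−4)) ≤ 1.037` (printed) is replaced by `≤ 1.04` (`exp_349_le`; at `T = 100` the
   left side is `1.03702…`).

## References

* D. H. J. Polymath, *Effective approximation of heat flow evolution of the Riemann `ξ` function,
  and a new upper bound for the de Bruijn–Newman constant*, Res. Math. Sci. 6 (2019), Paper 31
  (arXiv:1904.12438): §1 (formula for `α`), Thm. 1.3, Prop. 6.3 eq. (epsp-def), Cor. 6.4/6.5,
  §6.3 eqs. (ea-def)–(ec0-def), Prop. 6.6 (iv)–(vi) and its proof (eqs. (asig), (alphn)).
  [Polymath2019]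
-/

noncomputable section

open Complex MeasureTheory Set Filter Topology

open scoped Real ComplexConjugate

namespace Literature.NumberTheory.LFunctions

namespace Polymath15

/-! ## The objects of Prop. 6.3 and §6.3 -/

/-- `ε̃(σ + iT) = (0.397·9^σ/(a − 0.865) + 5/(3(T − 6))) exp(3.49/(T − 4))` (as a function of
`σ`, `T` and the Riemann–Siegel parameter `a`). [cite: Polymath2019, Prop. 6.3 eq. (epsp-def)] -/
def epsTilde (σ T a : ℝ) : ℝ :=
  (0.397 * (9 : ℝ) ^ σ / (a - 0.865) + 5 / (3 * (T - 6))) * Real.exp (3.49 / (T - 4))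

/-- The Riemann–Siegel parameter at height `T` after the `β_N = πi/4` shift: `T' = T + πt/8`,
`a = √(T'/2π)`; for `T = x/2` this is `√(x/4π + t/16)`, so `⌊a⌋ = rsN t x`.
[cite: Polymath2019, Prop. 6.3 and Cor. 6.4 eq. (tp-def)] -/
def rsA (t T : ℝ) : ℝ := Real.sqrt ((T + π * t / 8) / (2 * π))

/-- `e_A = |γ| Σ_{n≤N} n^y b_n^t n^{−(Re s_* + Re κ)} ε_{t,n}(s₋)`, `s₋ = (1 − y + ix)/2`.
[cite: Polymath2019, §6.3 eq. (ea-def)] -/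
def eA (t x y : ℝ) : ℝ :=
  ‖gamma t x y‖ * ∑ n ∈ Finset.Icc 1 (rsN t x),
    (n : ℝ) ^ y * bCoeff t n / (n : ℝ) ^ ((sStar t x y).re + (kappa t x y).re) *
      epsTN t n (sMinus x y)

/-- `e_B = Σ_{n≤N} b_n^t n^{−Re s_*} ε_{t,n}(s̄₊)`, `s̄₊ = (1 + y + ix)/2` (the source writes
`ε_{t,n}(s₊)`; `ε_{t,n}` depends on `|α − log n|` and `|Im s|` only, and Prop. 6.1 is applied to
`r_{t,n}^*(s₊) = conj r_{t,n}(s̄₊)`). [cite: Polymath2019, §6.3 eq. (eb-def)] -/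
def eB (t x y : ℝ) : ℝ :=
  ∑ n ∈ Finset.Icc 1 (rsN t x),
    bCoeff t n / (n : ℝ) ^ (sStar t x y).re * epsTN t n ((1 + y + x * I) / 2)

/-- `e_{C,0} = e^{tπ²/64} |M₀(iT')| (1 + ε̃(s₋) + ε̃(s₊)) / |M_t(s₊)|`, `T' = x/2 + πt/8`
(`|M_t(s₊)| = |B_t(x+iy)|`). [cite: Polymath2019, §6.3 eq. (ec0-def)] -/
def eC0 (t x y : ℝ) : ℝ :=
  Real.exp (t * π ^ 2 / 64) * ‖M₀ (I * (x / 2 + π * t / 8 : ℝ))‖ / ‖Bt t x y‖ *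
    (1 + epsTilde ((1 - y) / 2) (x / 2) (rsA t (x / 2)) + epsTilde ((1 + y) / 2) (x / 2) (rsA t (x / 2)))

/-! ## Real and imaginary parts of `α` (eq. (alpha-form)) -/

section AlphaParts

/-- `Re(1/(2s)) = Re s/(2|s|²)`. [cite: Polymath2019, §1, formula for α before Thm. 1.3] -/
theorem re_one_div_two_mul (s : ℂ) : (1 / (2 * s)).re = s.re / (2 * Complex.normSq s) := by
  rw [one_div, Complex.inv_re, Complex.mul_re, Complex.normSq_mul, Complex.normSq_ofNat]
  simp
  field_simp

/-- `Im(1/(2s)) = −Im s/(2|s|²)`. [cite: Polymath2019, §1, formula for α before Thm. 1.3] -/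
theorem im_one_div_two_mul (s : ℂ) : (1 / (2 * s)).im = -s.im / (2 * Complex.normSq s) := by
  rw [one_div, Complex.inv_im, Complex.mul_im, Complex.normSq_mul, Complex.normSq_ofNat]
  simp
  field_simp

/-- `Re(1/(s−1)) = (Re s − 1)/|s−1|²`. [cite: Polymath2019, §1, formula for α before Thm. 1.3] -/
theorem re_one_div_sub_one (s : ℂ) : (1 / (s - 1)).re = (s.re - 1) / Complex.normSq (s - 1) := by
  rw [one_div, Complex.inv_re]
  simp

/-- `Im(1/(s−1)) = −Im s/|s−1|²`. [cite: Polymath2019, §1, formula for α before Thm. 1.3] -/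
theorem im_one_div_sub_one (s : ℂ) : (1 / (s - 1)).im = -s.im / Complex.normSq (s - 1) := by
  rw [one_div, Complex.inv_im]
  simp

/-- `Re((1/2) Log(s/2π)) = (1/2) log(|s|/2π)`. [cite: Polymath2019, §1, formula for α before Thm. 1.3] -/
theorem re_half_log (s : ℂ) :
    (1 / 2 * Complex.log (s / (2 * π))).re = 1 / 2 * Real.log (‖s‖ / (2 * π)) := by
  rw [show (1 / 2 : ℂ) = ((1 / 2 : ℝ) : ℂ) by push_cast; ring, Complex.re_ofReal_mul,
    Complex.log_re, norm_div, show (2 * π : ℂ) = ((2 * π : ℝ) : ℂ) by push_cast; ring,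
    Complex.norm_real, Real.norm_of_nonneg (by positivity)]

/-- `Im((1/2) Log(s/2π)) = (1/2) arg s`. [cite: Polymath2019, §1, formula for α before Thm. 1.3] -/
theorem im_half_log (s : ℂ) : (1 / 2 * Complex.log (s / (2 * π))).im = 1 / 2 * Complex.arg s := by
  rw [show (1 / 2 : ℂ) = ((1 / 2 : ℝ) : ℂ) by push_cast; ring, Complex.im_ofReal_mul,
    Complex.log_im, show s / (2 * π : ℂ) = s * ((1 / (2 * π) : ℝ) : ℂ) by push_cast; field_simp,
    Complex.arg_mul_real (by positivity)]

/-- `Re α(s) = Re s/(2|s|²) + (Re s − 1)/|s − 1|² + (1/2) log(|s|/2π)`.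
[cite: Polymath2019, §1, formula for α before Thm. 1.3] -/
theorem re_alpha_eq (s : ℂ) : (alpha s).re =
    s.re / (2 * Complex.normSq s) + (s.re - 1) / Complex.normSq (s - 1) +
      1 / 2 * Real.log (‖s‖ / (2 * π)) := by
  rw [alpha, Complex.add_re, Complex.add_re, re_one_div_two_mul, re_one_div_sub_one, re_half_log]

/-- `Im α(s) = −Im s/(2|s|²) − Im s/|s − 1|² + (1/2) arg s`.
[cite: Polymath2019, §1, formula for α before Thm. 1.3] -/
theorem im_alpha_eq (s : ℂ) : (alpha s).im =
    -s.im / (2 * Complex.normSq s) + -s.im / Complex.normSq (s - 1) + 1 / 2 * Complex.arg s := by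
  rw [alpha, Complex.add_im, Complex.add_im, im_one_div_two_mul, im_one_div_sub_one, im_half_log]

/-- On the line `Im s = b > 0`, `0 ≤ Re s ≤ 1`: `−1/b² ≤ Re α(s) − (1/2) log(b/2π) ≤ 3/(4b²)`
(the real parts of `1/(2s)`, `1/(s−1)` and `(1/2) log(|s|/b) ≤ (Re s)²/(4b²)` taken exactly; the
printed (asig) `α(σ + ix/2) = (1/2) log(x/4π) + iπ/4 + O_≤((2+σ)/(x−6))` treats them crudely).
[cite: Polymath2019, Prop. 6.6, proof, eq. (asig)] -/
theorem re_alpha_sub_log_bounds {s : ℂ} (h0 : 0 ≤ s.re) (h1 : s.re ≤ 1) (hs : 0 < s.im) :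
    -(1 / s.im ^ 2) ≤ (alpha s).re - 1 / 2 * Real.log (s.im / (2 * π)) ∧
      (alpha s).re - 1 / 2 * Real.log (s.im / (2 * π)) ≤ 3 / (4 * s.im ^ 2) := by
  set a := s.re with ha
  set b := s.im with hb
  have hb2 : 0 < b ^ 2 := by positivity
  have hn0 : Complex.normSq s = a ^ 2 + b ^ 2 := by rw [Complex.normSq_apply]; ring
  have hn1 : Complex.normSq (s - 1) = (a - 1) ^ 2 + b ^ 2 := by
    rw [Complex.normSq_apply]; simp [ha, hb]; ring
  have hns : b ≤ ‖s‖ := le_trans (le_abs_self _) (Complex.abs_im_le_norm s)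
  have hnorm_pos : 0 < ‖s‖ := lt_of_lt_of_le hs hns
  -- term 1: `0 ≤ a/(2(a²+b²)) ≤ 1/(2b²)`
  have t1lo : 0 ≤ a / (2 * Complex.normSq s) := by rw [hn0]; positivity
  have t1hi : a / (2 * Complex.normSq s) ≤ 1 / (2 * b ^ 2) := by
    rw [hn0, div_le_div_iff₀ (by positivity) (by positivity)]
    nlinarith [sq_nonneg a]
  -- term 2: `-1/b² ≤ (a-1)/((a-1)²+b²) ≤ 0`
  have t2lo : -(1 / b ^ 2) ≤ (a - 1) / Complex.normSq (s - 1) := by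
    rw [hn1, neg_le, ← neg_div, div_le_div_iff₀ (by positivity) (by positivity)]
    nlinarith [sq_nonneg (a - 1)]
  have t2hi : (a - 1) / Complex.normSq (s - 1) ≤ 0 :=
    div_nonpos_of_nonpos_of_nonneg (by linarith) (Complex.normSq_nonneg _)
  -- term 3: `0 ≤ (1/2) log(|s|/2π) - (1/2) log(b/2π) ≤ 1/(4b²)`
  have hlog : Real.log (‖s‖ / (2 * π)) - Real.log (b / (2 * π)) = Real.log (‖s‖ / b) := by
    rw [← Real.log_div (by positivity) (by positivity)]
    congr 1
    field_simp
  have t3lo : 0 ≤ Real.log (‖s‖ / b) := Real.log_nonneg (by rw [le_div_iff₀ hs]; linarith)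
  have t3hi : Real.log (‖s‖ / b) ≤ 1 / (2 * b ^ 2) := by
    -- `|s| ≤ b + a²/(2b)` hence `|s|/b ≤ 1 + a²/(2b²) ≤ 1 + 1/(2b²)`
    have h1' : ‖s‖ ≤ b + a ^ 2 / (2 * b) := by
      have hsq : ‖s‖ ^ 2 = a ^ 2 + b ^ 2 := by rw [Complex.sq_norm, hn0]
      have hrhs : 0 ≤ b + a ^ 2 / (2 * b) := by positivity
      nlinarith [sq_nonneg (a ^ 2 / (2 * b)), show (b + a ^ 2 / (2 * b)) ^ 2 =
        b ^ 2 + a ^ 2 + (a ^ 2 / (2 * b)) ^ 2 by field_simp; ring]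
    have h2' : ‖s‖ / b ≤ 1 + 1 / (2 * b ^ 2) := by
      rw [div_le_iff₀ hs]
      have : a ^ 2 / (2 * b) ≤ 1 / (2 * b ^ 2) * b := by
        rw [show 1 / (2 * b ^ 2) * b = 1 / (2 * b) by field_simp]
        exact div_le_div_of_nonneg_right (by nlinarith) (by positivity)
      linarith
    have := Real.log_le_sub_one_of_pos (show 0 < ‖s‖ / b by positivity)
    linarith
  rw [re_alpha_eq, ← ha]
  have e3 : (4 : ℝ) * b ^ 2 = 2 * (2 * b ^ 2) := by ring
  have t3hi' : 1 / 2 * Real.log (‖s‖ / b) ≤ 1 / (4 * b ^ 2) := by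
    rw [e3, show 1 / (2 * (2 * b ^ 2)) = 1 / 2 * (1 / (2 * b ^ 2)) by field_simp]
    linarith
  constructor
  · linarith
  · have : 1 / (2 * b ^ 2) + 1 / (4 * b ^ 2) = 3 / (4 * b ^ 2) := by field_simp; ring
    linarith

/-- On `Re s ≥ 0`, `Im s ≥ 2`: `|Im α(s)| ≤ π/4` (`Im α = (1/2) arg s − Im s/(2|s|²) − Im s/|s−1|²`
with `0 ≤ arg s ≤ π/2` and `0 ≤ Im s/(2|s|²) + Im s/|s−1|² ≤ 3/(2 Im s) ≤ π/4`).
[cite: Polymath2019, Prop. 6.6, proof, eq. (asig)] -/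
theorem abs_im_alpha_le {s : ℂ} (h0 : 0 ≤ s.re) (hs : 2 ≤ s.im) : |(alpha s).im| ≤ π / 4 := by
  set b := s.im with hb
  have hbpos : 0 < b := by linarith
  have hn0 : b ^ 2 ≤ Complex.normSq s := by rw [Complex.normSq_apply]; nlinarith [sq_nonneg s.re]
  have hn1 : b ^ 2 ≤ Complex.normSq (s - 1) := by
    rw [Complex.normSq_apply]; simp [hb]; nlinarith [sq_nonneg (s.re - 1)]
  have hb2 : 0 < b ^ 2 := by positivity
  have hN0 : 0 < Complex.normSq s := lt_of_lt_of_le hb2 hn0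
  have hN1 : 0 < Complex.normSq (s - 1) := lt_of_lt_of_le hb2 hn1
  have t1lo : -(1 / (2 * b)) ≤ -b / (2 * Complex.normSq s) := by
    rw [neg_div, neg_le_neg_iff, div_le_div_iff₀ (by positivity) (by positivity)]
    nlinarith
  have t1hi : -b / (2 * Complex.normSq s) ≤ 0 := by
    rw [neg_div]; exact neg_nonpos.2 (by positivity)
  have t2lo : -(1 / b) ≤ -b / Complex.normSq (s - 1) := by
    rw [neg_div, neg_le_neg_iff, div_le_div_iff₀ hN1 hbpos]
    nlinarith
  have t2hi : -b / Complex.normSq (s - 1) ≤ 0 := by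
    rw [neg_div]; exact neg_nonpos.2 (by positivity)
  have t3lo : 0 ≤ Complex.arg s := Complex.arg_nonneg_iff.2 (by linarith)
  have t3hi : Complex.arg s ≤ π / 2 := Complex.arg_le_pi_div_two_iff.2 (Or.inl h0)
  have hπ : 3 / (2 * b) ≤ π / 4 := by
    rw [div_le_div_iff₀ (by positivity) (by norm_num)]
    nlinarith [Real.pi_gt_three]
  rw [im_alpha_eq, abs_le]
  constructor
  · have : 1 / (2 * b) + 1 / b = 3 / (2 * b) := by field_simp; ring
    nlinarith
  · nlinarith

end AlphaParts

/-! ## Prop. 6.6 (iv)–(v): the bound for `ε_{t,n}(s_±)` and `e_A + e_B ≤ errAB` -/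

section EpsBound

/-- `0 ≤ log(x/4π) ≤ x/12` for `x ≥ 200`. [folklore] -/
private theorem log_x_div_four_pi_bounds {x : ℝ} (hx : 200 ≤ x) :
    0 ≤ Real.log (x / (4 * π)) ∧ Real.log (x / (4 * π)) ≤ x / 12 := by
  have hπ := Real.pi_gt_three
  have hπ4 := Real.pi_lt_four
  have hu1 : 1 ≤ x / (4 * π) := by rw [le_div_iff₀ (by positivity)]; nlinarith
  refine ⟨Real.log_nonneg hu1, ?_⟩
  have h1 := Real.log_le_sub_one_of_pos (show 0 < x / (4 * π) by positivity)
  have h2 : x / (4 * π) ≤ x / 12 := div_le_div_of_nonneg_left (by linarith) (by norm_num) (by nlinarith)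
  linarith

/-- **The estimate (alphn), corrected form.** On the line `Im s = x/2` with `0 ≤ Re s ≤ 1`,
`x ≥ 200`, and for `1 ≤ n ≤ x/4π`:
`|α(s) − log n|² ≤ (1/4) log²(x/(4πn²)) + 0.667`. The printed derivation goes through (asig) with
the constant `3/(x−6)`, which undercounts `1/(s−1)`; here the real part of `α(s) − (1/2)log(x/4π)`
is `O_≤(4/x²)` exactly (`re_alpha_sub_log_bounds`) and `|Im α(s)| ≤ π/4` (`abs_im_alpha_le`), which
gives the printed constant with room (`π²/16 + 4 log(x/4π)/x² + 16/x⁴ ≤ 0.619`).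
[cite: Polymath2019, Prop. 6.6 (iv)–(v), proof, eq. (alphn)] -/
theorem norm_alpha_sub_log_sq_le {x : ℝ} (hx : 200 ≤ x) {s : ℂ} (hs : s.im = x / 2)
    (h0 : 0 ≤ s.re) (h1 : s.re ≤ 1) {n : ℕ} (hn : 1 ≤ n) (hnx : (n : ℝ) ≤ x / (4 * π)) :
    ‖alpha s - Real.log n‖ ^ 2 ≤ 1 / 4 * Real.log (x / (4 * π * (n : ℝ) ^ 2)) ^ 2 + 0.667 := by
  have hxpos : 0 < x := by linarith
  have hnpos : (0 : ℝ) < n := by exact_mod_cast (by omega : 0 < n)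
  set L : ℝ := Real.log (x / (4 * π)) with hL
  set l : ℝ := Real.log n with hl
  obtain ⟨hL0, hLle⟩ := log_x_div_four_pi_bounds hx
  have hl0 : 0 ≤ l := Real.log_natCast_nonneg n
  have hlL : l ≤ L := Real.log_le_log hnpos hnx
  have hLn : Real.log (x / (4 * π * (n : ℝ) ^ 2)) = L - 2 * l := by
    rw [hL, hl, Real.log_div hxpos.ne' (by positivity), Real.log_div hxpos.ne' (by positivity),
      Real.log_mul (by positivity) (by positivity), Real.log_pow]
    push_cast
    ring
  have hsim : 0 < s.im := by rw [hs]; positivity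
  obtain ⟨hlo, hhi⟩ := re_alpha_sub_log_bounds h0 h1 hsim
  rw [hs, show x / 2 / (2 * π) = x / (4 * π) by ring] at hlo hhi
  have hI := abs_im_alpha_le h0 (by rw [hs]; linarith)
  set e : ℝ := (alpha s).re - 1 / 2 * L with he
  have hre : (alpha s - (l : ℂ)).re = (L - 2 * l) / 2 + e := by
    simp only [Complex.sub_re, Complex.ofReal_re, he]; ring
  have him : (alpha s - (l : ℂ)).im = (alpha s).im := by simp
  have helo : -(4 / x ^ 2) ≤ e := by
    have : (1 : ℝ) / (x / 2) ^ 2 = 4 / x ^ 2 := by field_simp; ring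
    linarith
  have hehi : e ≤ 4 / x ^ 2 := by
    have : (3 : ℝ) / (4 * (x / 2) ^ 2) = 3 / x ^ 2 := by field_simp; ring
    have h4 : (3 : ℝ) / x ^ 2 ≤ 4 / x ^ 2 := div_le_div_of_nonneg_right (by norm_num) (by positivity)
    linarith
  have he_abs : |e| ≤ 4 / x ^ 2 := abs_le.2 ⟨helo, hehi⟩
  have hLn_abs : |L - 2 * l| ≤ L := abs_le.2 ⟨by linarith, by linarith⟩
  -- the pieces
  have hcross : (L - 2 * l) * e ≤ L * (4 / x ^ 2) := by
    calc (L - 2 * l) * e ≤ |(L - 2 * l) * e| := le_abs_self _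
      _ = |L - 2 * l| * |e| := abs_mul _ _
      _ ≤ L * (4 / x ^ 2) := mul_le_mul hLn_abs he_abs (abs_nonneg _) hL0
  have he2 : e * e ≤ 4 / x ^ 2 * (4 / x ^ 2) := by
    calc e * e = |e| * |e| := (abs_mul_abs_self e).symm
      _ ≤ 4 / x ^ 2 * (4 / x ^ 2) := mul_le_mul he_abs he_abs (abs_nonneg _) (by positivity)
  have hI2 : (alpha s).im * (alpha s).im ≤ π / 4 * (π / 4) := by
    calc (alpha s).im * (alpha s).im = |(alpha s).im| * |(alpha s).im| := (abs_mul_abs_self _).symm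
      _ ≤ π / 4 * (π / 4) := mul_le_mul hI hI (abs_nonneg _) (by positivity)
  have hπ16 : π / 4 * (π / 4) ≤ 0.61686 := by nlinarith [Real.pi_lt_d4, Real.pi_gt_three]
  have hsmall : L * (4 / x ^ 2) + 4 / x ^ 2 * (4 / x ^ 2) ≤ 0.002 := by
    have h1' : L * (4 / x ^ 2) ≤ x / 12 * (4 / x ^ 2) :=
      mul_le_mul_of_nonneg_right hLle (by positivity)
    have h2' : x / 12 * (4 / x ^ 2) = 1 / (3 * x) := by field_simp; ring
    have h3' : 1 / (3 * x) ≤ 1 / 600 := one_div_le_one_div_of_le (by norm_num) (by linarith)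
    have h4' : 4 / x ^ 2 ≤ 4 / 200 ^ 2 :=
      div_le_div_of_nonneg_left (by norm_num) (by positivity) (pow_le_pow_left₀ (by norm_num) hx 2)
    have h5' : 4 / x ^ 2 * (4 / x ^ 2) ≤ 4 / 200 ^ 2 * (4 / 200 ^ 2) :=
      mul_le_mul h4' h4' (by positivity) (by positivity)
    norm_num at h5'
    linarith
  rw [Complex.sq_norm, Complex.normSq_apply, hre, him, hLn]
  have hexp : ((L - 2 * l) / 2 + e) * ((L - 2 * l) / 2 + e) =
      1 / 4 * (L - 2 * l) ^ 2 + (L - 2 * l) * e + e * e := by ring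
  rw [hexp]
  linarith

/-- **The bound for `ε_{t,n}(s_±)`** (proof of Prop. 6.6 (iv)–(v)): on `Im s = x/2`, `0 ≤ Re s ≤ 1`,
in the region (1.6), for `1 ≤ n ≤ x/4π`,
`ε_{t,n}(s) ≤ exp(((t²/16) log²(x/(4πn²)) + 0.626)/(x − 6.66)) − 1`
(`(t²/8)·0.667 + t/4 + 1/6 ≤ 0.313`, `T − 3.33 = (x − 6.66)/2`).
[cite: Polymath2019, Prop. 6.6 (iv)–(v), proof] -/
theorem epsTN_le {t x : ℝ} (ht : 0 < t) (ht' : t ≤ 1 / 2) (hx : 200 ≤ x) {s : ℂ}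
    (hs : s.im = x / 2) (h0 : 0 ≤ s.re) (h1 : s.re ≤ 1) {n : ℕ} (hn : 1 ≤ n)
    (hnx : (n : ℝ) ≤ x / (4 * π)) :
    epsTN t n s ≤
      Real.exp ((t ^ 2 / 16 * Real.log (x / (4 * π * (n : ℝ) ^ 2)) ^ 2 + 0.626) / (x - 6.66)) - 1 := by
  have hA := norm_alpha_sub_log_sq_le hx hs h0 h1 hn hnx
  set A := ‖alpha s - Real.log n‖ ^ 2 with hAdef
  set Ln := Real.log (x / (4 * π * (n : ℝ) ^ 2)) with hLn
  rw [epsTN, hs]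
  refine sub_le_sub_right (Real.exp_le_exp.2 ?_) 1
  have hden : (0 : ℝ) < x - 6.66 := by linarith
  rw [show x / 2 - 3.33 = (x - 6.66) / 2 by ring, div_div_eq_mul_div]
  refine div_le_div_of_nonneg_right ?_ hden.le
  have ht2 : t ^ 2 ≤ 1 / 4 := by nlinarith
  have h1' : t ^ 2 / 8 * A ≤ t ^ 2 / 8 * (1 / 4 * Ln ^ 2 + 0.667) :=
    mul_le_mul_of_nonneg_left hA (by positivity)
  have h2' : t ^ 2 / 8 * 0.667 ≤ 1 / 4 / 8 * 0.667 := by nlinarith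
  nlinarith

/-- In the region (1.6), every index `n ≤ N = ⌊√(x/4π + t/16)⌋` of the Riemann–Siegel sums obeys
`1 ≤ n ≤ x/4π` ("`1 ≤ n² ≤ N² ≤ a² = (x + πt/4)/4π ≤ (x/4π)²`").
[cite: Polymath2019, Prop. 6.6 (iv)–(v), proof] -/
theorem le_of_mem_Icc_rsN {t x : ℝ} (ht' : t ≤ 1 / 2) (hx : 200 ≤ x) {n : ℕ}
    (hn : n ∈ Finset.Icc 1 (rsN t x)) : 1 ≤ n ∧ (n : ℝ) ≤ x / (4 * π) := by
  rw [Finset.mem_Icc] at hn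
  refine ⟨hn.1, ?_⟩
  have hπ := Real.pi_gt_three
  have hπ4 := Real.pi_lt_d2
  set u := x / (4 * π) with hu
  have hu15 : 15 ≤ u := by rw [hu, le_div_iff₀ (by positivity)]; nlinarith
  have hv0 : 0 ≤ Real.sqrt (u + t / 16) := Real.sqrt_nonneg _
  have h1 : (n : ℝ) ≤ Real.sqrt (u + t / 16) := by
    have := hn.2
    rw [rsN] at this
    exact (Nat.le_floor_iff hv0).1 this
  refine h1.trans ?_
  calc Real.sqrt (u + t / 16) ≤ Real.sqrt (u ^ 2) := Real.sqrt_le_sqrt (by nlinarith)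
    _ = u := Real.sqrt_sq (by linarith)

/-- `ε_{t,n}(s) ≥ 0` whenever `Im s > 3.33`. [cite: Polymath2019, Prop. 6.1 eq. (eps-def)] -/
theorem epsTN_nonneg {t : ℝ} {n : ℕ} {s : ℂ} (ht : 0 ≤ t) (hs : 3.33 < s.im) : 0 ≤ epsTN t n s := by
  rw [epsTN, sub_nonneg]
  exact Real.one_le_exp (div_nonneg (by positivity) (by linarith))

/-- The termwise inequality behind (iv) + (v): with `ε₁, ε₂ ≤ δ` and
`b/n^{Re s_* + Re κ} ≤ N^{|κ|} b/n^{Re s_*}`,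
`|γ| n^y (b/n^{Re s_*+Re κ}) ε₁ + (b/n^{Re s_*}) ε₂ ≤ (1 + |γ| N^{|κ|} n^y)(b/n^{Re s_*}) δ`. [folklore] -/
private theorem term_bound {γ P B D E NK ε₁ ε₂ δ : ℝ} (hγ : 0 ≤ γ) (hP : 0 ≤ P) (hB : 0 ≤ B)
    (hD : 0 < D) (hNK : 0 ≤ NK) (hBE : B / E ≤ NK * (B / D)) (hε₁ : 0 ≤ ε₁)
    (h1 : ε₁ ≤ δ) (h2 : ε₂ ≤ δ) :
    γ * (P * B / E * ε₁) + B / D * ε₂ ≤ (1 + γ * NK * P) * (B / D) * δ := by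
  have hBD : 0 ≤ B / D := div_nonneg hB hD.le
  have hδ : 0 ≤ δ := hε₁.trans h1
  have e1 : P * B / E * ε₁ ≤ P * (NK * (B / D)) * δ := by
    rw [show P * B / E = P * (B / E) by ring]
    exact mul_le_mul (mul_le_mul_of_nonneg_left hBE hP) h1 hε₁ (by positivity)
  have e2 : B / D * ε₂ ≤ B / D * δ := mul_le_mul_of_nonneg_left h2 hBD
  have e3 : γ * (P * B / E * ε₁) ≤ γ * (P * (NK * (B / D)) * δ) := mul_le_mul_of_nonneg_left e1 hγ
  calc γ * (P * B / E * ε₁) + B / D * ε₂ ≤ γ * (P * (NK * (B / D)) * δ) + B / D * δ := add_le_add e3 e2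
    _ = (1 + γ * NK * P) * (B / D) * δ := by ring

/-- **Polymath 15, Prop. 6.6 (iv) + (v)** in the combined form of Thm. 1.3: in the region (1.6),
`e_A + e_B ≤ Σ_{n≤N} (1 + |γ| N^{|κ|} n^y) (b_n^t/n^{Re s_*}) (exp(((t²/16)log²(x/4πn²) + 0.626)/(x − 6.66)) − 1)`
(`= errAB t x y`); uses `n^{−Re κ} ≤ N^{|κ|}` and `epsTN_le` at `s₋` and `s̄₊`.
[cite: Polymath2019, Prop. 6.6 (iv)–(v)] -/
theorem eA_add_eB_le_errAB {t x y : ℝ} (h : EffRegion t x y) : eA t x y + eB t x y ≤ errAB t x y := by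
  obtain ⟨ht, ht', hy0, hy1, hx⟩ := h
  have hxpos : 0 < x := by linarith
  set N := rsN t x with hN
  set γ : ℝ := ‖gamma t x y‖ with hγ
  set K : ℝ := ‖kappa t x y‖ with hK
  set σ : ℝ := (sStar t x y).re with hσ
  set κr : ℝ := (kappa t x y).re with hκr
  rw [eA, eB, errAB, Finset.mul_sum, ← Finset.sum_add_distrib]
  refine Finset.sum_le_sum fun n hn ↦ ?_
  obtain ⟨hn1, hnx⟩ := le_of_mem_Icc_rsN ht' hx hn
  have hnN : n ≤ N := (Finset.mem_Icc.1 hn).2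
  have hnpos : (0 : ℝ) < n := by exact_mod_cast (by omega : 0 < n)
  have hn1' : (1 : ℝ) ≤ n := by exact_mod_cast hn1
  -- the two values of ε
  have hsm_re : (sMinus x y).re = (1 - y) / 2 := by simp [sMinus]
  have hsm_im : (sMinus x y).im = x / 2 := by simp [sMinus]
  have hsm : (sMinus x y).im = x / 2 ∧ 0 ≤ (sMinus x y).re ∧ (sMinus x y).re ≤ 1 :=
    ⟨hsm_im, by rw [hsm_re]; linarith, by rw [hsm_re]; linarith⟩
  have hsp_re : ((1 + y + x * I) / 2 : ℂ).re = (1 + y) / 2 := by simp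
  have hsp_im : ((1 + y + x * I) / 2 : ℂ).im = x / 2 := by simp
  have hsp : ((1 + y + x * I) / 2 : ℂ).im = x / 2 ∧ 0 ≤ ((1 + y + x * I) / 2 : ℂ).re ∧
      ((1 + y + x * I) / 2 : ℂ).re ≤ 1 :=
    ⟨hsp_im, by rw [hsp_re]; linarith, by rw [hsp_re]; linarith⟩
  have hε₁ := epsTN_le ht ht' hx hsm.1 hsm.2.1 hsm.2.2 hn1 hnx
  have hε₂ := epsTN_le ht ht' hx hsp.1 hsp.2.1 hsp.2.2 hn1 hnx
  have hε₁0 : 0 ≤ epsTN t n (sMinus x y) := epsTN_nonneg ht.le (by rw [hsm.1]; linarith)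
  -- `b/n^{σ+κr} ≤ N^K b/n^σ`
  have hB : 0 ≤ bCoeff t n := (Real.exp_pos _).le
  have hD : 0 < (n : ℝ) ^ σ := Real.rpow_pos_of_pos hnpos σ
  have hNK : 0 ≤ (N : ℝ) ^ K := Real.rpow_nonneg (Nat.cast_nonneg N) K
  have hBE : bCoeff t n / (n : ℝ) ^ (σ + κr) ≤ (N : ℝ) ^ K * (bCoeff t n / (n : ℝ) ^ σ) := by
    rw [Real.rpow_add hnpos, show bCoeff t n / ((n : ℝ) ^ σ * (n : ℝ) ^ κr) =
      ((n : ℝ) ^ κr)⁻¹ * (bCoeff t n / (n : ℝ) ^ σ) by field_simp]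
    refine mul_le_mul_of_nonneg_right ?_ (div_nonneg hB hD.le)
    rw [← Real.rpow_neg hnpos.le]
    calc (n : ℝ) ^ (-κr) ≤ (n : ℝ) ^ K := by
          refine Real.rpow_le_rpow_of_exponent_le hn1' ?_
          have := Complex.abs_re_le_norm (kappa t x y)
          rw [hK, hκr]
          linarith [neg_abs_le (kappa t x y).re]
      _ ≤ (N : ℝ) ^ K := Real.rpow_le_rpow hnpos.le (by exact_mod_cast hnN) (norm_nonneg _)
  have := term_bound (norm_nonneg (gamma t x y)) (Real.rpow_nonneg hnpos.le y) hB hD hNK hBE hε₁0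
    hε₁ hε₂
  simpa only [hγ, hK, hσ, hκr, mul_div_assoc] using this

end EpsBound

/-! ## Prop. 6.6 (vi): the factor `e^{tπ²/64} |M₀(iT')|/|M_t(s₊)|` -/

section QBound

/-- `‖h‖² = (Re h)² + (Im h)²`. [folklore] -/
private theorem norm_sq_eq_re_im (h : ℂ) : ‖h‖ ^ 2 = h.re ^ 2 + h.im ^ 2 := by
  rw [Complex.sq_norm, Complex.normSq_apply]; ring

/-- `α(iT') = (1/2) log(T'/2π) + iπ/4 + O_≤(3/(2T'))`, exactly: `Re α(iT') = −1/(1+T'²) + (1/2)log(T'/2π)`,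
`Im α(iT') = π/4 − 1/(2T') − T'/(1+T'²)`. [cite: Polymath2019, Prop. 6.6 (vi), proof] -/
theorem alpha_I_mul_re_im {T' : ℝ} (hT' : 0 < T') :
    (alpha (I * T')).re = -(1 + T' ^ 2)⁻¹ + 1 / 2 * Real.log (T' / (2 * π)) ∧
      (alpha (I * T')).im = -(1 / 2) * T'⁻¹ - T' * (1 + T' ^ 2)⁻¹ + π / 4 := by
  set w₀ : ℂ := I * (T' : ℂ) with hw₀
  have hw_re : w₀.re = 0 := by simp [hw₀]
  have hw_im : w₀.im = T' := by simp [hw₀]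
  have hnw : Complex.normSq w₀ = T' ^ 2 := by rw [Complex.normSq_apply, hw_re, hw_im]; ring
  have hnw1 : Complex.normSq (w₀ - 1) = 1 + T' ^ 2 := by
    rw [Complex.normSq_apply]; simp [hw_re, hw_im]; ring
  have hnormw : ‖w₀‖ = T' := by
    rw [hw₀, norm_mul, Complex.norm_I, Complex.norm_real, Real.norm_of_nonneg hT'.le, one_mul]
  have hargw : Complex.arg w₀ = π / 2 := by
    rw [hw₀, show I * (T' : ℂ) = (T' : ℝ) * I by ring, Complex.arg_real_mul I hT', Complex.arg_I]
  constructor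
  · rw [re_alpha_eq, hnw1, hnormw, hw_re]; ring
  · rw [im_alpha_eq, hnw, hnw1, hargw, hw_im]
    have : -T' / (2 * T' ^ 2) = -(1 / 2) * T'⁻¹ := by
      rw [div_eq_iff (by positivity)]; field_simp
    rw [this]; ring

/-- The main term of `Re(α(iT') h)` for `h = (1+y)/2 − iπt/8` (so that `iT' + h = (1+y+ix)/2`):
`−Re(α(iT') h) ≤ −((1+y)/4) log(T'/2π) − π²t/32 + 1/(x − 6)` when `T' ≥ x/2`, `x ≥ 200`,
`0 ≤ y ≤ 1`, `0 < t ≤ 1/2` (the source budgets `3|h|/(2T') ≤ 3.06/(x−6)` for the error).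
[cite: Polymath2019, Prop. 6.6 (vi), proof] -/
theorem neg_re_alpha_mul_le {t x y T' : ℝ} (ht : 0 < t) (ht' : t ≤ 1 / 2)
    (hy1 : y ≤ 1) (hx : 200 ≤ x) (hT'ge : x / 2 ≤ T') {h : ℂ} (hh_re : h.re = (1 + y) / 2)
    (hh_im : h.im = -(π * t / 8)) :
    -(alpha (I * T') * h).re ≤ -((1 + y) / 4 * Real.log (T' / (2 * π))) - π ^ 2 * t / 32 + 1 / (x - 6) := by
  have hxpos : 0 < x := by linarith
  have hT'pos : 0 < T' := by linarith
  obtain ⟨hre, him⟩ := alpha_I_mul_re_im hT'pos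
  have hprod : (alpha (I * T') * h).re =
      (1 + y) / 4 * Real.log (T' / (2 * π)) + π ^ 2 * t / 32 -
        ((1 + y) / 2 * (1 + T' ^ 2)⁻¹ + π * t / 8 * (1 / 2 * T'⁻¹ + T' * (1 + T' ^ 2)⁻¹)) := by
    rw [Complex.mul_re, hre, him, hh_re, hh_im]; ring
  rw [hprod]
  have h1 : (1 + y) / 2 * (1 + T' ^ 2)⁻¹ ≤ 4 / x ^ 2 := by
    rw [← one_div, ← mul_div_assoc, mul_one, div_le_div_iff₀ (by positivity) (by positivity)]
    nlinarith
  have h2 : T' * (1 + T' ^ 2)⁻¹ ≤ T'⁻¹ := by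
    rw [← one_div, ← one_div, ← mul_div_assoc, mul_one, div_le_div_iff₀ (by positivity) hT'pos]
    nlinarith
  have h3 : T'⁻¹ ≤ 2 / x := by
    rw [← one_div, div_le_div_iff₀ hT'pos hxpos]; linarith
  have h5 : π * t / 8 * (1 / 2 * T'⁻¹ + T' * (1 + T' ^ 2)⁻¹) ≤ π / 16 * (3 / x) := by
    have h4 : 1 / 2 * T'⁻¹ + T' * (1 + T' ^ 2)⁻¹ ≤ 3 / x := by
      have e : (3 : ℝ) / x = 3 / 2 * (2 / x) := by ring
      rw [e]; linarith
    calc π * t / 8 * (1 / 2 * T'⁻¹ + T' * (1 + T' ^ 2)⁻¹) ≤ π * t / 8 * (3 / x) :=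
          mul_le_mul_of_nonneg_left h4 (by positivity)
      _ ≤ π / 16 * (3 / x) := by
          apply mul_le_mul_of_nonneg_right _ (by positivity)
          nlinarith [Real.pi_pos]
  have h6 : 4 / x ^ 2 + π / 16 * (3 / x) ≤ 1 / (x - 6) := by
    have hπ4 := Real.pi_lt_four
    have e : 4 / x ^ 2 + π / 16 * (3 / x) = (4 + 3 * π / 16 * x) / x ^ 2 := by
      field_simp
    rw [e, div_le_div_iff₀ (by positivity) (by linarith)]
    have hπx : 3 * π / 16 * x ≤ 3 / 4 * x := by nlinarith [hπ4, hxpos]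
    nlinarith [mul_le_mul_of_nonneg_right hπx (by linarith : (0:ℝ) ≤ x - 6)]
  linarith

/-- `Re α(s)² ≥ (1/4) log²(x/4π) − 4 log(x/4π)/x² − π²/16` on `Im s = x/2`, `0 ≤ Re s ≤ 1`,
`x ≥ 200` ("by repeating the proof of (alphn)"; here from `re_alpha_sub_log_bounds`,
`abs_im_alpha_le`). [cite: Polymath2019, Prop. 6.6 (vi), proof] -/
theorem re_alpha_sq_ge {x : ℝ} (hx : 200 ≤ x) {s : ℂ} (hs : s.im = x / 2) (h0 : 0 ≤ s.re)
    (h1 : s.re ≤ 1) :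
    Real.log (x / (4 * π)) ^ 2 / 4 - 4 * Real.log (x / (4 * π)) / x ^ 2 - π ^ 2 / 16 ≤
      (alpha s ^ 2).re := by
  have hxpos : 0 < x := by linarith
  obtain ⟨hL0, -⟩ := log_x_div_four_pi_bounds hx
  set L := Real.log (x / (4 * π)) with hL
  obtain ⟨hlo, -⟩ := re_alpha_sub_log_bounds h0 h1 (by rw [hs]; positivity)
  rw [hs, show x / 2 / (2 * π) = x / (4 * π) by ring] at hlo
  have hI := abs_im_alpha_le h0 (by rw [hs]; linarith)
  set e : ℝ := (alpha s).re - 1 / 2 * L with he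
  have helo : -(4 / x ^ 2) ≤ e := by
    have : (1 : ℝ) / (x / 2) ^ 2 = 4 / x ^ 2 := by field_simp; ring
    linarith
  have hre : (alpha s).re = L / 2 + e := by rw [he]; ring
  have hI2 : (alpha s).im * (alpha s).im ≤ π / 4 * (π / 4) := by
    calc (alpha s).im * (alpha s).im = |(alpha s).im| * |(alpha s).im| :=
          (abs_mul_abs_self _).symm
      _ ≤ π / 4 * (π / 4) := mul_le_mul hI hI (abs_nonneg _) (by positivity)
  rw [pow_two (alpha s), Complex.mul_re, hre]
  have h3 : (L / 2 + e) * (L / 2 + e) = L ^ 2 / 4 + L * e + e * e := by ring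
  have h4 : π / 4 * (π / 4) = π ^ 2 / 16 := by ring
  have h5 := mul_le_mul_of_nonneg_left helo hL0
  have h6 : L * -(4 / x ^ 2) = -(4 * L / x ^ 2) := by ring
  nlinarith [mul_self_nonneg e]

/-- `|h|² ≤ 1.04` for `h = (1+y)/2 − iπt/8`, `0 ≤ y ≤ 1`, `0 < t ≤ 1/2` (the source: `|h|²/2 ≤ 0.52`).
[cite: Polymath2019, Prop. 6.6 (vi), proof] -/
theorem norm_sq_shift_le {t y : ℝ} (ht : 0 < t) (ht' : t ≤ 1 / 2) (hy0 : 0 ≤ y) (hy1 : y ≤ 1)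
    {h : ℂ} (hh_re : h.re = (1 + y) / 2) (hh_im : h.im = -(π * t / 8)) : ‖h‖ ^ 2 ≤ 1.04 := by
  rw [norm_sq_eq_re_im, hh_re, hh_im]
  have h1 : ((1 + y) / 2) ^ 2 ≤ 1 := by nlinarith
  have h2 : (-(π * t / 8)) ^ 2 ≤ 0.04 := by
    rw [neg_sq]
    have hpt : π * t / 8 ≤ 0.2 := by nlinarith [Real.pi_lt_d4, Real.pi_pos]
    have hpt0 : 0 ≤ π * t / 8 := by positivity
    nlinarith
  linarith

/-- Bookkeeping of the exponents in the proof of Prop. 6.6 (vi):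
`tπ²/64 + Re log M₀(iT') − (t/4) Re α(s̄₊)² − Re log M₀(s̄₊) ≤ −((1+y)/4) L − (t/16)L² + L/(2x²) + 3.58/(x−6)`
from the Taylor step, `−Re(α(iT')h)`, `Re α(s̄₊)²`, `log(T'/2π) ≥ L` and `|h|² ≤ 1.04`. [folklore] -/
private theorem exponent_assembly {t x y L logT A Rw Rs P nh : ℝ} (ht' : t ≤ 1 / 2)
    (hx6 : 6 < x) (hL0 : 0 ≤ L)
    (hRe1 : Rw - Rs ≤ -P + nh / (2 * (x - 6)))
    (hRe2 : -P ≤ -((1 + y) / 4 * logT) - π ^ 2 * t / 32 + 1 / (x - 6))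
    (hαs : L ^ 2 / 4 - 4 * L / x ^ 2 - π ^ 2 / 16 ≤ A) (hlogT : L ≤ logT) (hnh : nh ≤ 1.04)
    (ht0 : 0 ≤ t) (hy0 : -1 ≤ y) :
    t * π ^ 2 / 64 + Rw - t / 4 * A - Rs ≤
      L * (-(1 + y) / 4) + (-(t / 16) * L ^ 2 + L / (2 * x ^ 2) + 3.58 / (x - 6)) := by
  have hx6' : (0 : ℝ) < x - 6 := by linarith
  have hxpos : (0 : ℝ) < x := by linarith
  have h1 : -((1 + y) / 4 * logT) ≤ -((1 + y) / 4 * L) := by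
    have := mul_le_mul_of_nonneg_left hlogT (by linarith : 0 ≤ (1 + y) / 4)
    linarith
  have h2 : t / 4 * (4 * L / x ^ 2) ≤ L / (2 * x ^ 2) := by
    rw [show t / 4 * (4 * L / x ^ 2) = t * (L / x ^ 2) by ring,
      show L / (2 * x ^ 2) = 1 / 2 * (L / x ^ 2) by ring]
    exact mul_le_mul_of_nonneg_right ht' (by positivity)
  have h3 : nh / (2 * (x - 6)) ≤ 0.52 / (x - 6) := by
    rw [div_le_div_iff₀ (by positivity) hx6']
    nlinarith
  have h4 : (1 : ℝ) / (x - 6) + 0.52 / (x - 6) ≤ 3.58 / (x - 6) := by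
    rw [← add_div]; exact div_le_div_of_nonneg_right (by norm_num) hx6'.le
  have h5 : t / 4 * (L ^ 2 / 4 - 4 * L / x ^ 2 - π ^ 2 / 16) ≤ t / 4 * A :=
    mul_le_mul_of_nonneg_left hαs (by linarith)
  nlinarith

/-- **Prop. 6.6 (vi), first half**: in the region (1.6), with `T' = x/2 + πt/8`, `s₊ = (1+y−ix)/2`,
`e^{tπ²/64} |M₀(iT')|/|M_t(s₊)| ≤ (x/4π)^{−(1+y)/4} exp(−(t/16) log²(x/4π) + log(x/4π)/(2x²) + 3.58/(x−6))`.
Printed proof: `|M_t(s₊)| = e^{(t/4) Re α(s₊)²} |M₀(s₊)|`, `|M₀(s₊)| = |M₀(s̄₊)|`, the Taylor expansion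
of `log M₀` from `iT'` to `s̄₊ = iT' + (1+y)/2 − πit/8` with `|α'| ≤ 1/(x−6)` (`|h|²/2 ≤ 0.52`),
`α(iT') = (1/2) log(T'/2π) + iπ/4 + O_≤(3/(2T'))`, and `Re α(s̄₊)² ≥ (1/4)log²(x/4π) − π²/16 − …`
(real and imaginary parts of `α` kept separately; the source states
`O_≤(3|log(x/4π)+iπ/2|/(x−6) + 9/(x−6)²)` for the last error). [cite: Polymath2019, Prop. 6.6 (vi), proof] -/
theorem Q_le {t x y : ℝ} (h : EffRegion t x y) :
    Real.exp (t * π ^ 2 / 64) * ‖M₀ (I * (x / 2 + π * t / 8 : ℝ))‖ / ‖Bt t x y‖ ≤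
      (x / (4 * π)) ^ (-(1 + y) / 4) *
        Real.exp (-(t / 16) * Real.log (x / (4 * π)) ^ 2 + Real.log (x / (4 * π)) / (2 * x ^ 2) +
          3.58 / (x - 6)) := by
  obtain ⟨ht, ht', hy0, hy1, hx⟩ := h
  have hxpos : 0 < x := by linarith
  have hπ3 := Real.pi_gt_three
  obtain ⟨hL0, -⟩ := log_x_div_four_pi_bounds hx
  set L : ℝ := Real.log (x / (4 * π)) with hL
  set T' : ℝ := x / 2 + π * t / 8 with hT'
  set s : ℂ := (1 + y + x * I) / 2 with hsdef
  set w₀ : ℂ := I * (T' : ℂ) with hw₀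
  set hh : ℂ := s - w₀ with hhh
  have hs_re : s.re = (1 + y) / 2 := by simp [hsdef]
  have hs_im : s.im = x / 2 := by simp [hsdef]
  have hw_im : w₀.im = T' := by simp [hw₀]
  have hT'ge : x / 2 ≤ T' := by
    rw [hT']; have := mul_pos Real.pi_pos ht; linarith
  have hT'pos : 0 < T' := by linarith
  have hh_re : hh.re = (1 + y) / 2 := by rw [hhh, Complex.sub_re, hs_re]; simp [hw₀]
  have hh_im : hh.im = -(π * t / 8) := by rw [hhh, Complex.sub_im, hs_im, hw_im, hT']; ring
  have hws : w₀ + hh = s := by rw [hhh]; ring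
  have hs0 : s ≠ 0 := fun e ↦ by
    have := congrArg Complex.im e; rw [hs_im] at this; simp at this; linarith
  have hs1 : s ≠ 1 := fun e ↦ by
    have := congrArg Complex.im e; rw [hs_im] at this; simp at this; linarith
  have hw0 : w₀ ≠ 0 := fun e ↦ by
    have := congrArg Complex.im e; rw [hw_im] at this; simp at this; linarith
  have hw1 : w₀ ≠ 1 := fun e ↦ by
    have := congrArg Complex.im e; rw [hw_im] at this; simp at this; linarith
  -- `|B_t| = |M_t(s̄₊)| = e^{(t/4) Re α(s)²} e^{Re log M₀(s)}`
  have hconj : sPlus x y = conj s := by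
    apply Complex.ext <;> simp [sPlus, hsdef, map_ofNat]
  have hBt : ‖Bt t x y‖ = ‖Mt t s‖ := by
    rw [Bt, hconj, norm_Mt_conj t (by rw [hs_im]; positivity)]
  have hre4 : ((t : ℂ) / 4 * alpha s ^ 2).re = t / 4 * (alpha s ^ 2).re := by
    rw [show (t : ℂ) / 4 = ((t / 4 : ℝ) : ℂ) by push_cast; ring, Complex.re_ofReal_mul]
  have hMt : ‖Mt t s‖ = Real.exp (t / 4 * (alpha s ^ 2).re) * Real.exp (logM₀ s).re := by
    rw [Mt, norm_mul, Complex.norm_exp, hre4, M₀_eq_exp_logM₀ hs0 hs1, Complex.norm_exp]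
  have hM₀w : ‖M₀ w₀‖ = Real.exp (logM₀ w₀).re := by
    rw [M₀_eq_exp_logM₀ hw0 hw1, Complex.norm_exp]
  have hQ : Real.exp (t * π ^ 2 / 64) * ‖M₀ (I * (x / 2 + π * t / 8 : ℝ))‖ / ‖Bt t x y‖ =
      Real.exp (t * π ^ 2 / 64 + (logM₀ w₀).re - t / 4 * (alpha s ^ 2).re - (logM₀ s).re) := by
    rw [hBt, hMt, show (I * (x / 2 + π * t / 8 : ℝ) : ℂ) = w₀ by rw [hw₀, hT'], hM₀w,
      ← Real.exp_add, ← Real.exp_add, ← Real.exp_sub]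
    congr 1
    ring
  -- Taylor expansion of `log M₀` from `w₀ = iT'` to `s`
  have hE₂ : ‖logM₀ s - logM₀ w₀ - alpha w₀ * hh‖ ≤ ‖hh‖ ^ 2 / (2 * (x - 6)) := by
    have := norm_logM₀_taylor_le (T₀ := x / 2) (s := w₀) (h := hh) (by linarith)
      (by rw [hw_im]; exact hT'ge) (by rw [hws, hs_im])
    rw [hws] at this
    refine this.trans (le_of_eq ?_)
    congr 1; ring
  have hRe1 : (logM₀ w₀).re - (logM₀ s).re ≤ -(alpha w₀ * hh).re + ‖hh‖ ^ 2 / (2 * (x - 6)) := by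
    have h1 := Complex.abs_re_le_norm (logM₀ s - logM₀ w₀ - alpha w₀ * hh)
    simp only [Complex.sub_re] at h1
    have h2 := (abs_le.1 (h1.trans hE₂)).1
    linarith
  have hRe2 := neg_re_alpha_mul_le (T' := T') ht ht' hy1 hx hT'ge hh_re hh_im
  have hαs := re_alpha_sq_ge hx hs_im (by rw [hs_re]; linarith) (by rw [hs_re]; linarith)
  -- `log(T'/2π) ≥ L`, `‖hh‖² ≤ 1.04`, and the bookkeeping
  have hlogT : L ≤ Real.log (T' / (2 * π)) := by
    rw [hL]
    refine Real.log_le_log (by positivity) ?_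
    rw [show x / (4 * π) = (x / 2) / (2 * π) by ring]
    exact div_le_div_of_nonneg_right hT'ge (by positivity)
  have hhn := norm_sq_shift_le ht ht' hy0 hy1 hh_re hh_im
  have hw₀' : alpha w₀ = alpha (I * T') := by rw [hw₀]
  rw [hw₀'] at hRe1
  have hexp := exponent_assembly (Rw := (logM₀ w₀).re) (Rs := (logM₀ s).re) (A := (alpha s ^ 2).re)
    ht' (by linarith) hL0 hRe1 hRe2 hαs hlogT hhn ht.le (by linarith)
  rw [hQ]
  calc Real.exp (t * π ^ 2 / 64 + (logM₀ w₀).re - t / 4 * (alpha s ^ 2).re - (logM₀ s).re)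
      ≤ Real.exp (L * (-(1 + y) / 4) + (-(t / 16) * L ^ 2 + L / (2 * x ^ 2) + 3.58 / (x - 6))) :=
        Real.exp_le_exp.2 hexp
    _ = _ := by
        rw [Real.exp_add, Real.rpow_def_of_pos (by positivity)]

end QBound

/-! ## Prop. 6.6 (vi), second half: `ε̃(s₋) + ε̃(s₊)` and `e_{C,0} ≤ errC0` -/

section EC0

/-- `rsA t (x/2) = √(x/4π + t/16)` (the `a` of Prop. 6.3 at `T = x/2` is the `a` of Thm. 1.3).
[cite: Polymath2019, Cor. 6.4, eq. (tp-def) and (N-def-main)] -/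
theorem rsA_half (t x : ℝ) : rsA t (x / 2) = Real.sqrt (x / (4 * π) + t / 16) := by
  rw [rsA]
  congr 1
  field_simp
  ring

/-- `N = ⌊a⌋ ≤ a`. [cite: Polymath2019, Prop. 6.2, eq. (N-def)] -/
theorem rsN_le_rsA (t x : ℝ) : (rsN t x : ℝ) ≤ rsA t (x / 2) := by
  rw [rsA_half, rsN]
  exact Nat.floor_le (Real.sqrt_nonneg _)

/-- In the region (1.6), `a = √(x/4π + t/16) ≥ 3.98`. [cite: Polymath2019, Prop. 6.6 (vi), proof] -/
theorem rsA_ge {t x : ℝ} (ht : 0 ≤ t) (hx : 200 ≤ x) : 3.98 ≤ rsA t (x / 2) := by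
  rw [rsA_half]
  have hπ := Real.pi_lt_d2
  have hπ0 := Real.pi_pos
  have h1 : (15.85 : ℝ) ≤ x / (4 * π) := by rw [le_div_iff₀ (by positivity)]; nlinarith
  have h2 : (3.98 : ℝ) ^ 2 ≤ x / (4 * π) + t / 16 := by nlinarith
  calc (3.98 : ℝ) = Real.sqrt (3.98 ^ 2) := (Real.sqrt_sq (by norm_num)).symm
    _ ≤ Real.sqrt (x / (4 * π) + t / 16) := Real.sqrt_le_sqrt h2

/-- In the region (1.6), `N ≥ 3`. [cite: Polymath2019, Prop. 6.6 (vi), proof] -/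
theorem three_le_rsN {t x : ℝ} (ht : 0 ≤ t) (hx : 200 ≤ x) : (3 : ℝ) ≤ rsN t x := by
  have h := rsA_ge ht hx
  rw [rsA_half] at h
  have : (3 : ℕ) ≤ rsN t x := by
    rw [rsN]
    exact Nat.le_floor (by push_cast; linarith)
  exact_mod_cast this

/-- `9^{u/2} = 3^u`. [folklore] -/
private theorem nine_rpow_half (u : ℝ) : (9 : ℝ) ^ (u / 2) = (3 : ℝ) ^ u := by
  rw [show (9 : ℝ) = (3 : ℝ) ^ (2 : ℝ) by norm_num, ← Real.rpow_mul (by norm_num)]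
  congr 1
  ring

/-- `9^{(1−y)/2} = 3·3^{−y}` and `9^{(1+y)/2} = 3·3^{y}` ("`9^σ` with `σ = (1±y)/2`").
[cite: Polymath2019, Prop. 6.6 (vi), proof] -/
theorem nine_rpow_sigma (y : ℝ) :
    (9 : ℝ) ^ ((1 - y) / 2) = 3 * (3 : ℝ) ^ (-y) ∧ (9 : ℝ) ^ ((1 + y) / 2) = 3 * (3 : ℝ) ^ y := by
  constructor
  · rw [nine_rpow_half, sub_eq_add_neg, Real.rpow_add (by norm_num), Real.rpow_one]
  · rw [nine_rpow_half, Real.rpow_add (by norm_num), Real.rpow_one]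

/-- `exp(3.49/(T − 4)) ≤ 1.04` for `T = x/2 ≥ 100` (the source prints `≤ 1.037`).
[cite: Polymath2019, Prop. 6.6 (vi), proof] -/
theorem exp_349_le {x : ℝ} (hx : 200 ≤ x) : Real.exp (3.49 / (x / 2 - 4)) ≤ 1.04 := by
  set z : ℝ := 3.49 / (x / 2 - 4) with hz
  have hz0 : 0 ≤ z := by rw [hz]; exact div_nonneg (by norm_num) (by linarith)
  have hz1 : z ≤ 0.0364 := by
    rw [hz, div_le_iff₀ (by linarith)]; linarith
  have hb := Real.abs_exp_sub_one_sub_id_le (x := z) (by rw [abs_of_nonneg hz0]; linarith)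
  have := (abs_le.1 hb).2
  nlinarith

/-- `ε̃ ≥ 0` when `a > 0.865` and `T > 6`. [cite: Polymath2019, Prop. 6.3 eq. (epsp-def)] -/
theorem epsTilde_nonneg {σ T a : ℝ} (ha : 0.865 < a) (hT : 6 < T) : 0 ≤ epsTilde σ T a := by
  rw [epsTilde]
  refine mul_nonneg (add_nonneg (div_nonneg ?_ (by linarith)) (div_nonneg (by norm_num) (by linarith)))
    (Real.exp_pos _).le
  exact mul_nonneg (by norm_num) (Real.rpow_nonneg (by norm_num) σ)

/-- (P1) of the corrected second half of (vi): the main term of `ε̃(s₋) + ε̃(s₊)` against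
`u + u²/2`, `u = 1.24(3^y+3^{−y})/(N − 0.125)`. [folklore] -/
private theorem main_term_le {m S a N u : ℝ} (hm1 : m ≤ 1.04) (hS2 : 2 ≤ S)
    (ha : 3.98 ≤ a) (hNa : N ≤ a) (hN3 : 3 ≤ N) (hu : u = 1.24 * S / (N - 0.125)) :
    m * (1.191 * S / (a - 0.865)) ≤ u + u ^ 2 / 2 := by
  have hS0 : 0 < S := by linarith
  have ha0 : (0 : ℝ) < a - 0.865 := by linarith
  have hb : (0 : ℝ) < a - 0.125 := by linarith
  have hN0 : (0 : ℝ) < N - 0.125 := by linarith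
  have hu0 : 0 ≤ u := by rw [hu]; positivity
  have huu₀ : 1.24 * S / (a - 0.125) ≤ u := by
    rw [hu]
    exact div_le_div_of_nonneg_left (by positivity) hN0 (by linarith)
  have hkey : 1.23864 / (a - 0.865) ≤ 1.24 / (a - 0.125) + 1.5376 / (a - 0.125) ^ 2 := by
    rw [div_add_div _ _ hb.ne' (by positivity), div_le_div_iff₀ ha0 (by positivity)]
    nlinarith [mul_pos hb hb, mul_pos ha0 hb]
  have h1 : m * (1.191 * S / (a - 0.865)) ≤ 1.23864 * S / (a - 0.865) := by
    rw [show m * (1.191 * S / (a - 0.865)) = (m * 1.191) * S / (a - 0.865) by ring]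
    exact div_le_div_of_nonneg_right (by nlinarith) ha0.le
  have h2 : 1.23864 * S / (a - 0.865) ≤ 1.24 * S / (a - 0.125) + 1.5376 * S / (a - 0.125) ^ 2 := by
    have := mul_le_mul_of_nonneg_left hkey hS0.le
    have e1 : S * (1.23864 / (a - 0.865)) = 1.23864 * S / (a - 0.865) := by ring
    have e2 : S * (1.24 / (a - 0.125) + 1.5376 / (a - 0.125) ^ 2) =
        1.24 * S / (a - 0.125) + 1.5376 * S / (a - 0.125) ^ 2 := by ring
    linarith
  have h3 : 1.5376 * S / (a - 0.125) ^ 2 ≤ (1.24 * S / (a - 0.125)) ^ 2 / 2 := by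
    have e : (1.24 * S / (a - 0.125)) ^ 2 / 2 = 0.7688 * S ^ 2 / (a - 0.125) ^ 2 := by
      rw [div_pow]; ring
    rw [e]
    exact div_le_div_of_nonneg_right (by nlinarith) (by positivity)
  have h4 : 1.24 * S / (a - 0.125) + (1.24 * S / (a - 0.125)) ^ 2 / 2 ≤ u + u ^ 2 / 2 := by
    have h0' : 0 ≤ 1.24 * S / (a - 0.125) := by positivity
    nlinarith [huu₀]
  linarith

/-- (P2) of the corrected second half of (vi): the additive term of `ε̃(s₋) + ε̃(s₊)` against
`(3|log(x/4π)+iπ/2| + 10.44)/(x−12) − log(x/4π)/(2x²) − 3.58/(x−6)`. [folklore] -/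
private theorem additive_term_le {m x L L' : ℝ} (hm1 : m ≤ 1.04) (hx : 200 ≤ x)
    (hLle : L ≤ x / 12) (hL' : π / 2 ≤ L') :
    m * (20 / (3 * (x - 12))) ≤ (3 * L' + 10.44) / (x - 12) - (L / (2 * x ^ 2) + 3.58 / (x - 6)) := by
  have hxpos : 0 < x := by linarith
  have hx12 : (0 : ℝ) < x - 12 := by linarith
  have h1 : m * (20 / (3 * (x - 12))) ≤ 6.94 / (x - 12) := by
    rw [← div_div, ← mul_div_assoc]
    exact div_le_div_of_nonneg_right (by linarith) hx12.le
  have h2 : 15.15 / (x - 12) ≤ (3 * L' + 10.44) / (x - 12) := by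
    refine div_le_div_of_nonneg_right ?_ hx12.le
    nlinarith [Real.pi_gt_d4]
  have h3 : 3.58 / (x - 6) ≤ 3.58 / (x - 12) :=
    div_le_div_of_nonneg_left (by norm_num) hx12 (by linarith)
  have h4 : L / (2 * x ^ 2) ≤ 0.05 / (x - 12) := by
    have h4a : L / (2 * x ^ 2) ≤ x / 12 / (2 * x ^ 2) :=
      div_le_div_of_nonneg_right hLle (by positivity)
    have h4b : x / 12 / (2 * x ^ 2) = 1 / (24 * x) := by
      field_simp
      ring
    have h5 : 1 / (24 * x) ≤ 0.05 / (x - 12) := by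
      rw [div_le_div_iff₀ (by positivity) hx12]; linarith
    linarith
  have h6 : 6.94 / (x - 12) + 3.58 / (x - 12) + 0.05 / (x - 12) ≤ 15.15 / (x - 12) := by
    rw [← add_div, ← add_div]; exact div_le_div_of_nonneg_right (by norm_num) hx12.le
  linarith

/-- **Prop. 6.6 (vi), second half (corrected)**: in the region (1.6),
`exp(log(x/4π)/(2x²) + 3.58/(x−6)) · (1 + ε̃(s₋) + ε̃(s₊)) ≤ exp(1.24(3^y+3^{−y})/(N − 0.125) + (3|log(x/4π)+iπ/2| + 10.44)/(x − 12))`.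
The printed step "`ε̃((1±y+ix)/2) ≤ 1.24·3^{±y}/(a − 0.125) + 1.73/(T−6)`" does not follow from
(epsp-def), whose denominator is `a − 0.865`; what we use instead is
`ε̃(s₋) + ε̃(s₊) = e^{3.49/(T−4)} (1.191 (3^y+3^{−y})/(a − 0.865) + 20/(3(x−12)))`, `N ≤ a`, `a ≥ 3.98`,
and `e^u ≥ 1 + u + u²/2` for `u = 1.24(3^y+3^{−y})/(N−0.125)`: the quadratic term absorbs the
discrepancy (`1.2386/(a−0.865) ≤ 1.24/(a−0.125) + 1.5376/(a−0.125)²` for `a ≥ 3.98`), so the bound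
of Thm. 1.3 holds as printed. [cite: Polymath2019, Prop. 6.6 (vi), proof] -/
theorem exp_mul_one_add_epsTilde_le {t x y : ℝ} (h : EffRegion t x y) :
    Real.exp (Real.log (x / (4 * π)) / (2 * x ^ 2) + 3.58 / (x - 6)) *
        (1 + epsTilde ((1 - y) / 2) (x / 2) (rsA t (x / 2)) +
          epsTilde ((1 + y) / 2) (x / 2) (rsA t (x / 2))) ≤
      Real.exp (1.24 * ((3 : ℝ) ^ y + (3 : ℝ) ^ (-y)) / ((rsN t x : ℝ) - 0.125) +
        (3 * ‖(Real.log (x / (4 * π)) : ℂ) + π / 2 * I‖ + 10.44) / (x - 12)) := by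
  obtain ⟨ht, ht', hy0, hy1, hx⟩ := h
  have hxpos : 0 < x := by linarith
  have hx12 : x - 12 ≠ 0 := by intro e; linarith
  obtain ⟨-, hLle⟩ := log_x_div_four_pi_bounds hx
  set L : ℝ := Real.log (x / (4 * π)) with hL
  set L' : ℝ := ‖(L : ℂ) + π / 2 * I‖ with hL'
  set a : ℝ := rsA t (x / 2) with hadef
  set N : ℝ := (rsN t x : ℝ) with hNdef
  set S : ℝ := (3 : ℝ) ^ y + (3 : ℝ) ^ (-y) with hS
  set m : ℝ := Real.exp (3.49 / (x / 2 - 4)) with hm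
  set c : ℝ := L / (2 * x ^ 2) + 3.58 / (x - 6) with hc
  set u : ℝ := 1.24 * S / (N - 0.125) with hu
  set w : ℝ := (3 * L' + 10.44) / (x - 12) with hw
  have ha : 3.98 ≤ a := rsA_ge ht.le hx
  have hNa : N ≤ a := rsN_le_rsA t x
  have hN3 : 3 ≤ N := three_le_rsN ht.le hx
  have h3y : 0 < (3 : ℝ) ^ y := Real.rpow_pos_of_pos (by norm_num) y
  have h3y' : (3 : ℝ) ^ (-y) = ((3 : ℝ) ^ y)⁻¹ := Real.rpow_neg (by norm_num) y
  have hS2 : 2 ≤ S := by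
    rw [hS, h3y']
    have hne : (3 : ℝ) ^ y ≠ 0 := h3y.ne'
    have e : (3 : ℝ) ^ y + ((3 : ℝ) ^ y)⁻¹ - 2 = ((3 : ℝ) ^ y - 1) ^ 2 / (3 : ℝ) ^ y := by
      field_simp; ring
    have h2 : 0 ≤ ((3 : ℝ) ^ y - 1) ^ 2 / (3 : ℝ) ^ y := by positivity
    linarith
  have hL'ge : π / 2 ≤ L' := by
    have h1 := Complex.abs_im_le_norm ((L : ℂ) + π / 2 * I)
    have him : ((L : ℂ) + π / 2 * I).im = π / 2 := by simp
    rw [him, abs_of_pos (by positivity)] at h1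
    exact h1
  have hm1 : m ≤ 1.04 := exp_349_le hx
  -- `ε̃(s₋) + ε̃(s₊)` in closed form
  obtain ⟨h9m, h9p⟩ := nine_rpow_sigma y
  have h5 : (5 : ℝ) / (3 * (x / 2 - 6)) = 10 / (3 * (x - 12)) := by
    rw [div_eq_div_iff (by intro e; apply hx12; linarith) (by positivity)]; ring
  have hE : epsTilde ((1 - y) / 2) (x / 2) a + epsTilde ((1 + y) / 2) (x / 2) a =
      m * (1.191 * S / (a - 0.865)) + m * (20 / (3 * (x - 12))) := by
    rw [epsTilde, epsTilde, h9m, h9p, h5, ← hm, hS]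
    ring
  have hP1 : m * (1.191 * S / (a - 0.865)) ≤ u + u ^ 2 / 2 := main_term_le hm1 hS2 ha hNa hN3 hu
  have hP2 : m * (20 / (3 * (x - 12))) ≤ w - c := additive_term_le hm1 hx hLle hL'ge
  have hu0 : 0 ≤ u := by
    rw [hu]; exact div_nonneg (by linarith) (by linarith)
  have hm0 : 0 < m := Real.exp_pos _
  have hwc : 0 ≤ w - c :=
    le_trans (mul_nonneg hm0.le (div_nonneg (by norm_num) (by linarith))) hP2
  have h1E : 1 + epsTilde ((1 - y) / 2) (x / 2) a + epsTilde ((1 + y) / 2) (x / 2) a ≤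
      (1 + u + u ^ 2 / 2) * (1 + (w - c)) := by
    rw [add_assoc, hE]
    nlinarith [mul_nonneg (add_nonneg hu0 (by positivity : 0 ≤ u ^ 2 / 2)) hwc]
  have h2E : (1 + u + u ^ 2 / 2) * (1 + (w - c)) ≤ Real.exp u * Real.exp (w - c) :=
    mul_le_mul (Real.quadratic_le_exp_of_nonneg hu0) (by linarith [Real.add_one_le_exp (w - c)])
      (by linarith) (Real.exp_pos _).le
  calc Real.exp c * (1 + epsTilde ((1 - y) / 2) (x / 2) a + epsTilde ((1 + y) / 2) (x / 2) a)
      ≤ Real.exp c * (Real.exp u * Real.exp (w - c)) :=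
        mul_le_mul_of_nonneg_left (h1E.trans h2E) (Real.exp_pos _).le
    _ = Real.exp (u + w) := by
        rw [← Real.exp_add, ← Real.exp_add]; congr 1; ring

/-- **Polymath 15, Prop. 6.6 (vi)** in the form of Thm. 1.3: in the region (1.6), `e_{C,0} ≤ errC0`,
i.e. `e^{tπ²/64}|M₀(iT')|(1 + ε̃(s₋) + ε̃(s₊))/|M_t(s₊)| ≤
(x/4π)^{−(1+y)/4} exp(−(t/16)log²(x/4π) + 1.24(3^y+3^{−y})/(N−0.125) + (3|log(x/4π)+iπ/2|+10.44)/(x−12))`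
(`Q_le`, `exp_mul_one_add_epsTilde_le`, and `1 + u ≤ e^u`). [cite: Polymath2019, Prop. 6.6 (vi) and Thm. 1.3] -/
theorem eC0_le_errC0 {t x y : ℝ} (h : EffRegion t x y) : eC0 t x y ≤ errC0 t x y := by
  have hQ := Q_le h
  have hF := exp_mul_one_add_epsTilde_le h
  obtain ⟨ht, ht', hy0, hy1, hx⟩ := h
  have ha : 3.98 ≤ rsA t (x / 2) := rsA_ge ht.le hx
  have hE0 : 0 ≤ 1 + epsTilde ((1 - y) / 2) (x / 2) (rsA t (x / 2)) +
      epsTilde ((1 + y) / 2) (x / 2) (rsA t (x / 2)) := by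
    have h1 := epsTilde_nonneg (σ := (1 - y) / 2) (T := x / 2) (by linarith : 0.865 < rsA t (x / 2))
      (by linarith)
    have h2 := epsTilde_nonneg (σ := (1 + y) / 2) (T := x / 2) (by linarith : 0.865 < rsA t (x / 2))
      (by linarith)
    linarith
  set L : ℝ := Real.log (x / (4 * π)) with hL
  set c : ℝ := L / (2 * x ^ 2) + 3.58 / (x - 6) with hc
  set u : ℝ := 1.24 * ((3 : ℝ) ^ y + (3 : ℝ) ^ (-y)) / ((rsN t x : ℝ) - 0.125) with hu
  set w : ℝ := (3 * ‖(L : ℂ) + π / 2 * I‖ + 10.44) / (x - 12) with hw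
  set E : ℝ := 1 + epsTilde ((1 - y) / 2) (x / 2) (rsA t (x / 2)) +
      epsTilde ((1 + y) / 2) (x / 2) (rsA t (x / 2)) with hEdef
  set P : ℝ := (x / (4 * π)) ^ (-(1 + y) / 4) with hP
  have hP0 : 0 ≤ P := Real.rpow_nonneg (by positivity) _
  rw [eC0, errC0]
  calc Real.exp (t * π ^ 2 / 64) * ‖M₀ (I * (x / 2 + π * t / 8 : ℝ))‖ / ‖Bt t x y‖ * E
      ≤ P * Real.exp (-(t / 16) * L ^ 2 + L / (2 * x ^ 2) + 3.58 / (x - 6)) * E :=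
        mul_le_mul_of_nonneg_right hQ hE0
    _ = P * Real.exp (-(t / 16) * L ^ 2) * (Real.exp c * E) := by
        rw [show -(t / 16) * L ^ 2 + L / (2 * x ^ 2) + 3.58 / (x - 6) = -(t / 16) * L ^ 2 + c by
          rw [hc]; ring, Real.exp_add]
        ring
    _ ≤ P * Real.exp (-(t / 16) * L ^ 2) * Real.exp (u + w) :=
        mul_le_mul_of_nonneg_left hF (by positivity)
    _ = P * Real.exp (-(t / 16) * L ^ 2 + u + w) := by
        rw [add_assoc, Real.exp_add (-(t / 16) * L ^ 2)]
        ring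

end EC0

/-! ## E4a: the error majorants of Thm. 1.3 -/

/-- **Polymath 15, Prop. 6.6 (iv)–(vi)** ⇒ the error majorants of Thm. 1.3 (THEORY-R6 item E4a
`error_majorants`): in the region (1.6), `e_A + e_B ≤ errAB` and `e_{C,0} ≤ errC0`.
[cite: Polymath2019, Prop. 6.6 (iv)–(vi)] -/
theorem error_majorants :
    ∀ t x y : ℝ, EffRegion t x y → eA t x y + eB t x y ≤ errAB t x y ∧ eC0 t x y ≤ errC0 t x y :=
  fun _ _ _ h ↦ ⟨eA_add_eB_le_errAB h, eC0_le_errC0 h⟩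

end Polymath15

end Literature.NumberTheory.LFunctions

end
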